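import Literature.NumberTheory.LFunctions.HardyZFirstApprox
import Summits.RiemannHypothesis.RiemannHypothesis.Theorems.UniversalFactorNarrowKernelNoGoEnergyLowerPhase
import Literature.NumberTheory.LFunctions.ZetaMeanSquareLowerBound

/-!
# RiemannHypothesis / UniversalFactor — `NarrowKernelNoGo`, stub K1b (energy upper bound), part 2:
the kernel majorant, Hardy's first approximation everywhere, and the phase of `E₁`

Route `RiemannHypothesis/UniversalFactor`, crux `NarrowKernelNoGo` (stmt-RiemannHypothesis-2576), line
`Sketch`, stub `stub_narrowEnergyUpper`. Throughout, `E : ℝ → ℝ` is an abstract nonnegative envelope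
(in the stub: `E(τ) = ‖γ(1/2+iτ)‖`, `γ = xiGammaFactor`), `w(t) = t^{-7/4} e^{πt/4}`, and
`k : ℝ → ℝ` an abstract kernel with `|k(u)| ≤ B e^{-2a|u|}`, `a > π/8`. This file provides:

* `UniversalFactor.narrowUpper_envelope_majorant` (registered sub-stub; `…_of` is the working form) — from the global bound
  `E(τ) ≤ C₀ (1+|τ|)^{7/4} e^{-π|τ|/4}`: `E(t+u) w(t) ≤ C₀ (2+|u|)² e^{-πu/4}` for `t ≥ 1`, all `u`, and
  `UniversalFactor.narrowUpper_kernel_majorant` — `|k(u)| E(t+u) w(t) ≤ B C₀ (2+|u|)² e^{-(2a−π/4)|u|}`;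
* `UniversalFactor.narrowUpper_abs_hardyZ_le`, `UniversalFactor.narrowUpper_continuous_hardyZErr`,
  `UniversalFactor.narrowUpper_norm_hardyZErr_le_crude`, `UniversalFactor.narrowUpper_hardyZ_eq` —
  Hardy's `Z = 2 Re(E₁ S_P) + Re e_P` as an identity on all of `ℝ` with crude bounds
  (`|Z(τ)| ≤ 2 + 2|τ|`, `‖e_P(τ)‖ ≤ 2 + 2|τ| + 4√P`);
* `UniversalFactor.narrowUpper_phase_taylor` — `|φ(t+u) − φ(t) − u φ'(t)| ≤ u²/(2t)` for `|u| ≤ t/2`,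
  `φ(τ) = (τ/2) log(τ/2π) − τ/2 − π/8` the phase of `E₁ = thetaMainPhase`, `φ' = ½ log(τ/2π)`
  (with the lead's `UniversalFactor.norm_cexp_I_sub_cexp_I_le`, `‖e^{ia} − e^{ib}‖ ≤ |a − b|`).

References: Titchmarsh, *The Theory of the Riemann Zeta-Function* (1986), §4.17, §7.3–7.4, §9.20.
-/

noncomputable section

-- D-0017: `Summit.<S>.<S>.…` is the designed namespace of a single-problem summit.
set_option linter.dupNamespace false

namespace Summit.RiemannHypothesis.RiemannHypothesis.Theorems

open MeasureTheory Set Filter Complex intervalIntegral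
open scoped Real Topology
open Literature.NumberTheory.LFunctions

/-! ## The weight and the envelope majorant -/

/-- `w(t) = t^{-7/4} e^{πt/4} > 0` for `t > 0`. [folklore] -/
theorem UniversalFactor.narrowUpper_weight_pos {t : ℝ} (ht : 0 < t) :
    0 < t ^ (-(7 : ℝ) / 4) * Real.exp (π * t / 4) :=
  mul_pos (Real.rpow_pos_of_pos ht _) (Real.exp_pos _)

/-- **The envelope against the weight, crude global form.** If `E(τ) ≤ C₀ (1+|τ|)^{7/4} e^{-π|τ|/4}` for
all real `τ` and `E ≥ 0`, then for `t ≥ 1` and every real `u`,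
`E(t+u) · t^{-7/4} e^{πt/4} ≤ C₀ (2+|u|)² e^{-πu/4}` (for `u ≥ −t` the exponents cancel exactly; for
`u < −t`, `π(2t+u)/4 ≤ −πu/4`). [folklore] -/
theorem UniversalFactor.narrowUpper_envelope_majorant_of {E : ℝ → ℝ} {C₀ : ℝ}
    (hE : ∀ τ : ℝ, E τ ≤ C₀ * (1 + |τ|) ^ ((7 : ℝ) / 4) * Real.exp (-(π * |τ| / 4)))
    (hE0 : ∀ τ : ℝ, 0 ≤ E τ) {t : ℝ} (ht : 1 ≤ t) (u : ℝ) :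
    E (t + u) * (t ^ (-(7 : ℝ) / 4) * Real.exp (π * t / 4)) ≤
      C₀ * (2 + |u|) ^ 2 * Real.exp (-(π * u / 4)) := by
  have ht0 : 0 < t := by linarith
  have hC0 : 0 ≤ C₀ := by
    have h := (hE0 0).trans (hE 0)
    simpa using h
  have hw := UniversalFactor.narrowUpper_weight_pos ht0
  -- the power
  have hpow : (1 + |t + u|) ^ ((7 : ℝ) / 4) * t ^ (-(7 : ℝ) / 4) ≤ (2 + |u|) ^ 2 := by
    rw [show (-(7 : ℝ) / 4) = -((7 : ℝ) / 4) by ring, Real.rpow_neg ht0.le, ← div_eq_mul_inv,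
      ← Real.div_rpow (by positivity) ht0.le]
    have hq : (1 + |t + u|) / t ≤ 2 + |u| := by
      rw [div_le_iff₀ ht0]
      have h1 : |t + u| ≤ t + |u| := (abs_add_le t u).trans (by rw [abs_of_pos ht0])
      nlinarith [abs_nonneg u]
    have hq0 : 0 ≤ (1 + |t + u|) / t := by positivity
    calc ((1 + |t + u|) / t) ^ ((7 : ℝ) / 4) ≤ (2 + |u|) ^ ((7 : ℝ) / 4) :=
          Real.rpow_le_rpow hq0 hq (by norm_num)
      _ ≤ (2 + |u|) ^ ((2 : ℕ) : ℝ) :=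
          Real.rpow_le_rpow_of_exponent_le (by linarith [abs_nonneg u]) (by norm_num)
      _ = (2 + |u|) ^ 2 := Real.rpow_natCast _ 2
  -- the exponential
  have hexp : Real.exp (-(π * |t + u| / 4)) * Real.exp (π * t / 4) ≤ Real.exp (-(π * u / 4)) := by
    rw [← Real.exp_add]
    refine Real.exp_le_exp.2 ?_
    have h1 : t + u ≤ |t + u| := le_abs_self _
    nlinarith [Real.pi_pos]
  calc E (t + u) * (t ^ (-(7 : ℝ) / 4) * Real.exp (π * t / 4))
      ≤ (C₀ * (1 + |t + u|) ^ ((7 : ℝ) / 4) * Real.exp (-(π * |t + u| / 4))) *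
          (t ^ (-(7 : ℝ) / 4) * Real.exp (π * t / 4)) :=
        mul_le_mul_of_nonneg_right (hE _) hw.le
    _ = C₀ * ((1 + |t + u|) ^ ((7 : ℝ) / 4) * t ^ (-(7 : ℝ) / 4)) *
          (Real.exp (-(π * |t + u| / 4)) * Real.exp (π * t / 4)) := by ring
    _ ≤ C₀ * (2 + |u|) ^ 2 * Real.exp (-(π * u / 4)) := by gcongr

/-- **The kernel majorant.** With `|k(u)| ≤ B e^{-2a|u|}` and the envelope majorant, for `t ≥ 1` and
all `u`: `|k(u)| E(t+u) w(t) ≤ B C₀ (2+|u|)² e^{-(2a−π/4)|u|}` — an integrable, `t`-independent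
majorant `K(u)` of the filtered integrand. [folklore] -/
theorem UniversalFactor.narrowUpper_kernel_majorant {E k : ℝ → ℝ} {C₀ B a : ℝ}
    (hmaj : ∀ t : ℝ, 1 ≤ t → ∀ u : ℝ, E (t + u) * (t ^ (-(7 : ℝ) / 4) * Real.exp (π * t / 4)) ≤
      C₀ * (2 + |u|) ^ 2 * Real.exp (-(π * u / 4)))
    (hE0 : ∀ τ : ℝ, 0 ≤ E τ) (hk : ∀ u : ℝ, |k u| ≤ B * Real.exp (-(2 * a * |u|)))
    {t : ℝ} (ht : 1 ≤ t) (u : ℝ) :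
    |k u| * (E (t + u) * (t ^ (-(7 : ℝ) / 4) * Real.exp (π * t / 4))) ≤
      B * C₀ * ((2 + |u|) ^ 2 * Real.exp (-((2 * a - π / 4) * |u|))) := by
  have ht0 : 0 < t := by linarith
  have hB : 0 ≤ B := by have := (abs_nonneg _).trans (hk 0); simpa using this
  have hw := UniversalFactor.narrowUpper_weight_pos ht0
  have hEw : 0 ≤ E (t + u) * (t ^ (-(7 : ℝ) / 4) * Real.exp (π * t / 4)) := mul_nonneg (hE0 _) hw.le
  calc |k u| * (E (t + u) * (t ^ (-(7 : ℝ) / 4) * Real.exp (π * t / 4)))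
      ≤ (B * Real.exp (-(2 * a * |u|))) * (C₀ * (2 + |u|) ^ 2 * Real.exp (-(π * u / 4))) :=
        mul_le_mul (hk u) (hmaj t ht u) hEw (by positivity)
    _ = B * C₀ * ((2 + |u|) ^ 2 * (Real.exp (-(2 * a * |u|)) * Real.exp (-(π * u / 4)))) := by ring
    _ ≤ B * C₀ * ((2 + |u|) ^ 2 * Real.exp (-((2 * a - π / 4) * |u|))) := by
        have hC0 : 0 ≤ C₀ := by
          have h := hmaj 1 le_rfl 0
          have h1 : 0 ≤ E (1 + 0) * ((1:ℝ) ^ (-(7 : ℝ) / 4) * Real.exp (π * 1 / 4)) :=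
            mul_nonneg (hE0 _) (UniversalFactor.narrowUpper_weight_pos one_pos).le
          have h2 : C₀ * (2 + |(0:ℝ)|) ^ 2 * Real.exp (-(π * 0 / 4)) = 4 * C₀ := by simp; ring
          linarith
        gcongr
        rw [← Real.exp_add]
        refine Real.exp_le_exp.2 ?_
        have h : -u ≤ |u| := neg_le_abs u
        nlinarith [Real.pi_pos]

/-! ## Hardy's function and the first approximation on all of `ℝ` -/

/-- `|Z(τ)| ≤ 2 + 2|τ|` (`|Z| = |ζ(1/2+iτ)|` and Titchmarsh (2.12.2)). [cite: Titchmarsh1986, §2.12] -/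
theorem UniversalFactor.narrowUpper_abs_hardyZ_le (τ : ℝ) : |hardyZ τ| ≤ 2 + 2 * |τ| := by
  rw [abs_hardyZ_eq_norm_riemannZeta_holds τ]
  exact ZetaMeanSquare.norm_riemannZeta_line_le τ

/-- The phase `E₁ = thetaMainPhase` is continuous on all of `ℝ` (`t log t → 0`). [folklore] -/
theorem UniversalFactor.narrowUpper_continuous_thetaMainPhase : Continuous TwistedMoment.thetaMainPhase := by
  have hdef : TwistedMoment.thetaMainPhase = fun t : ℝ =>
      cexp (I * ((t / 2 * Real.log (t / (2 * π)) - t / 2 - π / 8 : ℝ) : ℂ)) :=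
    funext TwistedMoment.thetaMainPhase_def
  rw [hdef]
  have h1 : Continuous fun t : ℝ => t / 2 * Real.log (t / (2 * π)) := by
    have heq : (fun t : ℝ => t / 2 * Real.log (t / (2 * π))) =
        fun t : ℝ => π * (t / (2 * π) * Real.log (t / (2 * π))) := by
      funext t; field_simp
    rw [heq]
    exact continuous_const.mul (Real.continuous_mul_log.comp (continuous_id.div_const _))
  have h2 : Continuous fun t : ℝ => (t / 2 * Real.log (t / (2 * π)) - t / 2 - π / 8 : ℝ) :=
    (h1.sub (continuous_id.div_const _)).sub continuous_const
  exact Complex.continuous_exp.comp (continuous_const.mul (Complex.continuous_ofReal.comp h2))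

/-- `e_P = hardyZErr P` is continuous on all of `ℝ`. [folklore] -/
theorem UniversalFactor.narrowUpper_continuous_hardyZErr (P : ℕ) : Continuous (TwistedMoment.hardyZErr P) := by
  have hz : Continuous fun t : ℝ => TwistedMoment.thetaMainPhase t * TwistedMoment.mainSum P t :=
    UniversalFactor.narrowUpper_continuous_thetaMainPhase.mul (TwistedMoment.continuous_mainSum P)
  have hdef : TwistedMoment.hardyZErr P = fun t : ℝ => (hardyZ t : ℂ) -
      TwistedMoment.thetaMainPhase t * TwistedMoment.mainSum P t -
      (starRingEnd ℂ) (TwistedMoment.thetaMainPhase t * TwistedMoment.mainSum P t) :=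
    funext (TwistedMoment.hardyZErr_def P)
  rw [hdef]
  exact ((Complex.continuous_ofReal.comp continuous_hardyZ).sub hz).sub (Complex.continuous_conj.comp hz)

/-- Crude size of the first-approximation error everywhere: `‖e_P(τ)‖ ≤ 2 + 2|τ| + 4√P`. [folklore] -/
theorem UniversalFactor.narrowUpper_norm_hardyZErr_le_crude (P : ℕ) (τ : ℝ) :
    ‖TwistedMoment.hardyZErr P τ‖ ≤ 2 + 2 * |τ| + 4 * Real.sqrt P := by
  rw [TwistedMoment.hardyZErr_def]
  have hz : ‖TwistedMoment.thetaMainPhase τ * TwistedMoment.mainSum P τ‖ ≤ 2 * Real.sqrt P := by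
    rw [norm_mul, TwistedMoment.norm_thetaMainPhase, one_mul]
    exact TwistedMoment.norm_mainSum_le P τ
  have hZ : ‖(hardyZ τ : ℂ)‖ ≤ 2 + 2 * |τ| := by
    rw [Complex.norm_real, Real.norm_eq_abs]; exact UniversalFactor.narrowUpper_abs_hardyZ_le τ
  calc ‖(hardyZ τ : ℂ) - TwistedMoment.thetaMainPhase τ * TwistedMoment.mainSum P τ -
        (starRingEnd ℂ) (TwistedMoment.thetaMainPhase τ * TwistedMoment.mainSum P τ)‖
      ≤ ‖(hardyZ τ : ℂ)‖ + ‖TwistedMoment.thetaMainPhase τ * TwistedMoment.mainSum P τ‖ +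
          ‖(starRingEnd ℂ) (TwistedMoment.thetaMainPhase τ * TwistedMoment.mainSum P τ)‖ :=
        norm_sub_le_of_le (norm_sub_le _ _) le_rfl
    _ ≤ (2 + 2 * |τ|) + 2 * Real.sqrt P + 2 * Real.sqrt P := by
        rw [Complex.norm_conj]; gcongr
    _ = 2 + 2 * |τ| + 4 * Real.sqrt P := by ring

/-- **`Z = 2 Re(E₁ S_P) + Re e_P` on all of `ℝ`** (the definition of `e_P = Z − E₁S_P − conj(E₁S_P)`,
real parts). [cite: Titchmarsh1986, §9.23] -/
theorem UniversalFactor.narrowUpper_hardyZ_eq (P : ℕ) (τ : ℝ) :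
    hardyZ τ = 2 * (TwistedMoment.thetaMainPhase τ * TwistedMoment.mainSum P τ).re +
      (TwistedMoment.hardyZErr P τ).re := by
  rw [TwistedMoment.hardyZErr_def, Complex.sub_re, Complex.sub_re, Complex.ofReal_re, Complex.conj_re]
  ring

/-! ## The phase of `E₁` -/

/-- `x log x − (x − 1) ∈ [0, (x−1)²]` for `x > 0`. [folklore] -/
theorem UniversalFactor.narrowUpper_mul_log_sub_le {x : ℝ} (hx : 0 < x) :
    0 ≤ x * Real.log x - (x - 1) ∧ x * Real.log x - (x - 1) ≤ (x - 1) ^ 2 := by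
  have h1 := Real.one_sub_inv_le_log_of_pos hx
  have h2 := Real.log_le_sub_one_of_pos hx
  have h3 : x - 1 ≤ x * Real.log x := by
    have := mul_le_mul_of_nonneg_left h1 hx.le
    rwa [mul_sub, mul_one, mul_inv_cancel₀ hx.ne'] at this
  have h4 : x * Real.log x ≤ x * (x - 1) := mul_le_mul_of_nonneg_left h2 hx.le
  constructor <;> nlinarith

/-- **Linearisation of the phase of `E₁`.** With `φ(τ) = (τ/2) log(τ/2π) − τ/2 − π/8` (so that
`E₁(τ) = e^{iφ(τ)}`, `φ'(τ) = ½ log(τ/2π)`, `φ''(τ) = 1/(2τ)`): for `t > 0` and `|u| ≤ t/2`,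
`|φ(t+u) − φ(t) − u·½log(t/2π)| ≤ u²/(2t)` (exactly: `φ(t+u) − φ(t) − uφ'(t) = (t/2)(y log y − (y−1))`,
`y = 1 + u/t`). [folklore] -/
theorem UniversalFactor.narrowUpper_phase_taylor {t u : ℝ} (ht : 0 < t) (hu : |u| ≤ t / 2) :
    |((t + u) / 2 * Real.log ((t + u) / (2 * π)) - (t + u) / 2 - π / 8) -
        (t / 2 * Real.log (t / (2 * π)) - t / 2 - π / 8) - u * (1 / 2 * Real.log (t / (2 * π)))| ≤
      u ^ 2 / (2 * t) := by
  have hu' := abs_le.1 hu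
  have htu : 0 < t + u := by linarith
  have h2π : (0 : ℝ) < 2 * π := by positivity
  set y := (t + u) / t with hy
  have hy0 : 0 < y := by positivity
  have hlog1 : Real.log ((t + u) / (2 * π)) = Real.log (t + u) - Real.log (2 * π) :=
    Real.log_div htu.ne' h2π.ne'
  have hlog2 : Real.log (t / (2 * π)) = Real.log t - Real.log (2 * π) := Real.log_div ht.ne' h2π.ne'
  have hlogy : Real.log y = Real.log (t + u) - Real.log t := by rw [hy]; exact Real.log_div htu.ne' ht.ne'
  have key : ((t + u) / 2 * Real.log ((t + u) / (2 * π)) - (t + u) / 2 - π / 8) -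
      (t / 2 * Real.log (t / (2 * π)) - t / 2 - π / 8) - u * (1 / 2 * Real.log (t / (2 * π))) =
      t / 2 * (y * Real.log y - (y - 1)) := by
    rw [hlog1, hlog2, hlogy, hy]
    field_simp
    ring
  rw [key]
  obtain ⟨h0, h1⟩ := UniversalFactor.narrowUpper_mul_log_sub_le hy0
  rw [abs_of_nonneg (by positivity), show u ^ 2 / (2 * t) = t / 2 * ((y - 1) ^ 2) by
    rw [hy]; field_simp; ring]
  exact mul_le_mul_of_nonneg_left h1 (by positivity)

/-- `E₁(t) e^{iLu} = e^{i(φ(t) + Lu)}` and `E₁(t+u) = e^{iφ(t+u)}`: the distance of the two unit phases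
is at most `|φ(t+u) − φ(t) − Lu| ≤ u²/(2t)` for `L = ½log(t/2π)`, `|u| ≤ t/2`. [folklore] -/
theorem UniversalFactor.narrowUpper_norm_thetaMainPhase_sub_le {t u : ℝ} (ht : 0 < t) (hu : |u| ≤ t / 2) :
    ‖TwistedMoment.thetaMainPhase (t + u) -
        TwistedMoment.thetaMainPhase t * cexp (↑(1 / 2 * Real.log (t / (2 * π)) * u) * I)‖ ≤
      u ^ 2 / (2 * t) := by
  rw [TwistedMoment.thetaMainPhase_def, TwistedMoment.thetaMainPhase_def, ← Complex.exp_add]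
  have h : I * (((t / 2 * Real.log (t / (2 * π)) - t / 2 - π / 8 : ℝ)) : ℂ) +
      ↑(1 / 2 * Real.log (t / (2 * π)) * u) * I =
      I * ((t / 2 * Real.log (t / (2 * π)) - t / 2 - π / 8 + u * (1 / 2 * Real.log (t / (2 * π))) : ℝ) : ℂ) := by
    push_cast; ring
  rw [h]
  refine (UniversalFactor.norm_cexp_I_sub_cexp_I_le _ _).trans ?_
  have := UniversalFactor.narrowUpper_phase_taylor ht hu
  rwa [show ((t + u) / 2 * Real.log ((t + u) / (2 * π)) - (t + u) / 2 - π / 8 -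
      (t / 2 * Real.log (t / (2 * π)) - t / 2 - π / 8 + u * (1 / 2 * Real.log (t / (2 * π))))) =
    ((t + u) / 2 * Real.log ((t + u) / (2 * π)) - (t + u) / 2 - π / 8) -
      (t / 2 * Real.log (t / (2 * π)) - t / 2 - π / 8) - u * (1 / 2 * Real.log (t / (2 * π))) by ring]

/-- **Registered sub-stub `narrowUpper_envelope_majorant`** (verbatim signature): the envelope against the weight,
crude global form. [folklore] -/
theorem UniversalFactor.narrowUpper_envelope_majorant : ∀ {E : ℝ → ℝ} {C₀ : ℝ}, (∀ τ : ℝ, E τ ≤ C₀ * (1 + |τ|) ^ ((7 : ℝ) / 4) * Real.exp (-(Real.pi * |τ| / 4))) → (∀ τ : ℝ, 0 ≤ E τ) → ∀ {t : ℝ}, 1 ≤ t → ∀ u : ℝ, E (t + u) * (t ^ (-(7 : ℝ) / 4) * Real.exp (Real.pi * t / 4)) ≤ C₀ * (2 + |u|) ^ 2 * Real.exp (-(Real.pi * u / 4)) :=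
  fun hE hE0 _ ht u => UniversalFactor.narrowUpper_envelope_majorant_of hE hE0 ht u

end Summit.RiemannHypothesis.RiemannHypothesis.Theorems
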